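import Summits.NavierStokesRegularity.NavierStokesRegularity.Theses.SqueezeCycle
import Literature.Analysis.FluidPDE.LerayGaugeStrainSpectrum
import Summits.NavierStokesRegularity.NavierStokesRegularity.Theorems.MustSqueeze.Negative.GaussianVortex

/-!
# Crux `MustSqueeze` (stmt-NavierStokesRegularity-11610), negative side: the clauses, and the crux without the Oseen identity is false

Negative-side (cdisprove, D-0016) support lemmas extracted from the crux work file
`Cruxes/MustSqueeze/Disproof.lean` v7 so that ideators / planners / provers can IMPORT them:

* the named clauses `H1`–`H6`, `InClass`, `VanishesOnPast` of the crux and the read-back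
  `mustSqueeze_iff : MustSqueeze ↔ ∀ C u, InClass C u → H6 (1/8) u → VanishesOnPast u` (`Iff.rfl`);
  `h6_iff_lerayMiddleStrain_le` (H6 is `Λ_u ≤ a` everywhere); `mustSqueeze_holds_of_nonpos`
  (`C ≤ 0` is trivially true); `inClass_zero` (hypotheses satisfiable: the zero field);
* `mustSqueeze_false_without_H3` — with ONLY the KNSS/Oseen mild clause H3 deleted the statement
  is FALSE: the Gaussian vortex `wit` of `Negative/GaussianVortex.lean` satisfies H1, H2, H4, H5,
  H6 with the explicit constant `Cw` and is not zero.  Hence the typed side clauses hide no junk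
  and any proof of the crux must use the PDE.

No statement of the route is changed; nothing here closes the item (`--supports`).
-/

noncomputable section

namespace Summit.NavierStokesRegularity.NavierStokesRegularity.Theorems.MustSqueeze.Negative

open MeasureTheory Set Filter Topology
open Literature.Analysis.FluidPDE Literature.Analysis.UnboundedOperators
open Summit.NavierStokesRegularity.NavierStokesRegularity.Theses.SqueezeCycle

/-! ## The crux over named clauses -/

/-- H1: smoothness on `t < 0` (verbatim clause of the crux). -/
def H1 (u : ℝ → (EuclideanSpace ℝ (Fin 3)) → (EuclideanSpace ℝ (Fin 3))) : Prop :=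
  ContDiffOn ℝ (⊤ : ℕ∞) (Function.uncurry u) (Set.Iio 0 ×ˢ Set.univ)

/-- H2: divergence free on `t < 0` (verbatim). -/
def H2 (u : ℝ → (EuclideanSpace ℝ (Fin 3)) → (EuclideanSpace ℝ (Fin 3))) : Prop :=
  ∀ t < 0, Literature.Analysis.FluidPDE.VectorCalculus.IsDivFree (u t)

/-- The written-out bilinear Oseen integrand of clause H3 (verbatim). -/
def oseenIntegrand (u : ℝ → (EuclideanSpace ℝ (Fin 3)) → (EuclideanSpace ℝ (Fin 3))) (t τ : ℝ) (x y : (EuclideanSpace ℝ (Fin 3))) : (EuclideanSpace ℝ (Fin 3)) :=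
  ((-(inner ℝ (x-y) (u τ y) / (2*(t-τ)) * Literature.Analysis.UnboundedOperators.heatKernel (t-τ) (x-y))) • u τ y + (∫ σ in Set.Ioi (t-τ), Literature.Analysis.UnboundedOperators.heatKernel σ (x-y) / (4*σ^2)) • (inner ℝ (x-y) (u τ y) • u τ y + inner ℝ (u τ y) (u τ y) • (x-y) + inner ℝ (x-y) (u τ y) • u τ y) - ((∫ σ in Set.Ioi (t-τ), Literature.Analysis.UnboundedOperators.heatKernel σ (x-y) / (8*σ^3)) * (inner ℝ (x-y) (u τ y) * inner ℝ (x-y) (u τ y))) • (x-y))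

/-- H3: the KNSS/Oseen mild identity between any two negative times (verbatim). -/
def H3 (u : ℝ → (EuclideanSpace ℝ (Fin 3)) → (EuclideanSpace ℝ (Fin 3))) : Prop :=
  ∀ s t : ℝ, s < t → t < 0 → ∀ x, u t x = Literature.Analysis.FluidPDE.heatFlow (u s) (t-s) x -
    ∫ τ in Set.Ioo s t, ∫ y, oseenIntegrand u t τ x y

/-- H4: Type-I decay in time (verbatim). -/
def H4 (C : ℝ) (u : ℝ → (EuclideanSpace ℝ (Fin 3)) → (EuclideanSpace ℝ (Fin 3))) : Prop :=
  Literature.Analysis.FluidPDE.HasTypeITimeDecay C u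

/-- H5: scale-invariant local energies `A, E ≤ C` on every backward cylinder with top `t₀ ≤ 0`
(verbatim). -/
def H5 (C : ℝ) (u : ℝ → (EuclideanSpace ℝ (Fin 3)) → (EuclideanSpace ℝ (Fin 3))) : Prop :=
  ∀ (x₀ : EuclideanSpace ℝ (Fin 3)) (t₀ r : ℝ), t₀ ≤ 0 → 0 < r → (∀ t, t₀ - r^2 < t → t < t₀ → r⁻¹ * ∫ x in Metric.ball x₀ r, ‖u t x‖^2 ≤ C) ∧ r⁻¹ * ∫ t in Set.Ioo (t₀ - r^2) t₀, ∫ x in Metric.ball x₀ r, ‖fderiv ℝ (u t) x‖^2 ≤ C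

/-- H6 with threshold `a`: the Courant–Fischer form of `Λ_u(t,x) = (−t)λ₂(S) ≤ a` everywhere
(`a = 1/8` in the crux; cf. `lerayMiddleStrain_le_iff`). -/
def H6 (a : ℝ) (u : ℝ → (EuclideanSpace ℝ (Fin 3)) → (EuclideanSpace ℝ (Fin 3))) : Prop :=
  ∀ t < 0, ∀ x, (∃ v w : EuclideanSpace ℝ (Fin 3), ‖v‖ = 1 ∧ ‖w‖ = 1 ∧ inner ℝ v w = 0 ∧ ∀ α β : ℝ, (-t) * inner ℝ (fderiv ℝ (u t) x (α • v + β • w)) (α • v + β • w) ≤ a * (α^2 + β^2))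

/-- Membership in the Type-I model class `𝒦_C`: H1 ∧ H2 ∧ H3 ∧ H4 ∧ H5. -/
def InClass (C : ℝ) (u : ℝ → (EuclideanSpace ℝ (Fin 3)) → (EuclideanSpace ℝ (Fin 3))) : Prop :=
  H1 u ∧ H2 u ∧ H3 u ∧ H4 C u ∧ H5 C u

/-- The conclusion of the crux: `u ≡ 0` on `t < 0`. -/
def VanishesOnPast (u : ℝ → (EuclideanSpace ℝ (Fin 3)) → (EuclideanSpace ℝ (Fin 3))) : Prop :=
  ∀ t < 0, ∀ x, u t x = 0

/-- **Read-back.** The crux is, definitionally, `InClass C u → H6 (1/8) u → u ≡ 0 on t < 0`. -/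
theorem mustSqueeze_iff :
    MustSqueeze ↔ ∀ (C : ℝ) (u : ℝ → (EuclideanSpace ℝ (Fin 3)) → (EuclideanSpace ℝ (Fin 3))), InClass C u → H6 (1/8) u → VanishesOnPast u :=
  Iff.rfl

/-- H6 in the Leray-gauge vocabulary of `LerayGaugeStrainSpectrum`: `Λ_u(t,x) ≤ a` everywhere. -/
theorem h6_iff_lerayMiddleStrain_le (a : ℝ) (u : ℝ → (EuclideanSpace ℝ (Fin 3)) → (EuclideanSpace ℝ (Fin 3))) :
    H6 a u ↔ ∀ t < 0, ∀ x, lerayMiddleStrain u t x ≤ a := by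
  refine forall_congr' fun t => forall_congr' fun ht => forall_congr' fun x => ?_
  rw [lerayMiddleStrain_le_iff ht]

/-- Degenerate instance `C ≤ 0`: H4 alone forces `u ≡ 0`, so the crux holds trivially there
(the class is empty for `C < 0` and `{0}` for `C = 0`).  Intended under `∀ C`; not a defect. -/
theorem vanishes_of_h4_nonpos {C : ℝ} (hC : C ≤ 0) {u : ℝ → (EuclideanSpace ℝ (Fin 3)) → (EuclideanSpace ℝ (Fin 3))} (h4 : H4 C u) :
    VanishesOnPast u := by
  intro t ht x
  have h := h4 t ht x
  have hs : 0 < Real.sqrt (-t) := Real.sqrt_pos.2 (by linarith)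
  have : C / Real.sqrt (-t) ≤ 0 := div_nonpos_of_nonpos_of_nonneg hC hs.le
  exact norm_le_zero_iff.1 (h.trans this)

/-- The crux restricted to `C ≤ 0` is true for trivial reasons. -/
theorem mustSqueeze_holds_of_nonpos (C : ℝ) (hC : C ≤ 0) (u : ℝ → (EuclideanSpace ℝ (Fin 3)) → (EuclideanSpace ℝ (Fin 3))) (hu : InClass C u)
    (_h6 : H6 (1 / 8) u) : VanishesOnPast u :=
  vanishes_of_h4_nonpos hC hu.2.2.2.1

/-! ### The zero field is a member (hypotheses satisfiable; conclusion also satisfied) -/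

/-- `e₀, e₁`: an orthonormal pair in `(EuclideanSpace ℝ (Fin 3))`. -/
theorem orthonormal_pair :
    ‖(EuclideanSpace.single 0 1 : (EuclideanSpace ℝ (Fin 3)))‖ = 1 ∧ ‖(EuclideanSpace.single 1 1 : (EuclideanSpace ℝ (Fin 3)))‖ = 1 ∧
      inner ℝ (EuclideanSpace.single 0 1 : (EuclideanSpace ℝ (Fin 3))) (EuclideanSpace.single 1 1 : (EuclideanSpace ℝ (Fin 3))) = 0 := by
  refine ⟨by simp, by simp, ?_⟩
  rw [EuclideanSpace.inner_single_left]
  simp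

/-- A field whose every time slice has zero gradient satisfies H6 for every `a ≥ 0`. -/
theorem h6_of_fderiv_eq_zero {a : ℝ} (ha : 0 ≤ a) {u : ℝ → (EuclideanSpace ℝ (Fin 3)) → (EuclideanSpace ℝ (Fin 3))}
    (h : ∀ t < 0, ∀ x, fderiv ℝ (u t) x = 0) : H6 a u := by
  intro t ht x
  refine ⟨EuclideanSpace.single 0 1, EuclideanSpace.single 1 1, orthonormal_pair.1,
    orthonormal_pair.2.1, orthonormal_pair.2.2, fun α β => ?_⟩
  rw [h t ht x]
  simp only [zero_apply, inner_zero_left, mul_zero]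
  positivity

/-- The zero field lies in `𝒦_C` for every `C ≥ 0` and is squeezed: the hypotheses of the crux
are satisfiable (not vacuous), and the witness also satisfies the conclusion. -/
theorem inClass_zero {C : ℝ} (hC : 0 ≤ C) : InClass C (fun _ _ => 0) ∧ H6 (1 / 8) (fun _ _ => 0) := by
  refine ⟨⟨?_, ?_, ?_, ?_, ?_⟩, ?_⟩
  · exact contDiffOn_const
  · intro t _ x
    simp [VectorCalculus.divergence]
  · intro s t _ _ x
    have h0 : Literature.Analysis.FluidPDE.heatFlow (fun _ : (EuclideanSpace ℝ (Fin 3)) => (0 : (EuclideanSpace ℝ (Fin 3)))) (t - s) = fun _ => 0 := by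
      by_cases hts : 0 < t - s
      · rw [heatFlow_of_pos _ hts]
        funext y
        rw [heatExtension_apply]
        simp
      · exact heatFlow_of_nonpos _ (not_lt.1 hts)
    simp [oseenIntegrand, h0]
  · intro t ht x
    have hs : 0 < Real.sqrt (-t) := Real.sqrt_pos.2 (by linarith)
    simpa using div_nonneg hC hs.le
  · intro x₀ t₀ r _ hr
    refine ⟨fun t _ _ => ?_, ?_⟩
    · simpa using by positivity
    · simpa using by positivity
  · exact h6_of_fderiv_eq_zero (by norm_num) fun t _ x => by simp


/-! ## The crux without H3 is false: the Gaussian vortex is in every other clause -/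

/-- H1: the witness is smooth (globally, hence on `t < 0`). -/
theorem wit_h1 : H1 wit := by
  have hs : ContDiff ℝ (⊤ : ℕ∞) (fun p : ℝ × (EuclideanSpace ℝ (Fin 3)) => amp * Real.exp (p.1 / 2)) :=
    contDiff_const.mul (Real.contDiff_exp.comp (contDiff_fst.div_const 2))
  have hg : ContDiff ℝ (⊤ : ℕ∞) (fun p : ℝ × (EuclideanSpace ℝ (Fin 3)) => gauss p.2) :=
    Real.contDiff_exp.comp ((contDiff_snd (E := ℝ) (F := (EuclideanSpace ℝ (Fin 3)))).norm_sq ℝ).neg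
  have hr : ContDiff ℝ (⊤ : ℕ∞) (fun p : ℝ × (EuclideanSpace ℝ (Fin 3)) => rot p.2) := rot.contDiff.comp contDiff_snd
  have h : ContDiff ℝ (⊤ : ℕ∞) (fun p : ℝ × (EuclideanSpace ℝ (Fin 3)) => (amp * Real.exp (p.1 / 2)) • (gauss p.2 • rot p.2)) :=
    hs.smul (hg.smul hr)
  exact h.contDiffOn

/-- H2: the witness is divergence free (`div = −2g⟪x, rot x⟫ + g·tr rot = 0`). -/
theorem wit_h2 : H2 wit := by
  intro t _ x
  rw [VectorCalculus.divergence, fderiv_wit]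
  have hb := divergence_eq_sum_inner_fderiv (EuclideanSpace.basisFun (Fin 3) ℝ) (wit t) x
  rw [VectorCalculus.divergence, fderiv_wit] at hb
  rw [hb, Fin.sum_univ_three]
  simp only [EuclideanSpace.basisFun_apply, FunLike.coe_smul, Pi.smul_apply,
    EuclideanSpace.inner_single_left]
  simp only [DW_apply, map_one, one_mul]
  have hc := rot_coord x
  have h0 := rot_coord (EuclideanSpace.single (0 : Fin 3) (1 : ℝ) : (EuclideanSpace ℝ (Fin 3)))
  have h1 := rot_coord (EuclideanSpace.single (1 : Fin 3) (1 : ℝ) : (EuclideanSpace ℝ (Fin 3)))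
  have h2 := rot_coord (EuclideanSpace.single (2 : Fin 3) (1 : ℝ) : (EuclideanSpace ℝ (Fin 3)))
  simp only [PiLp.add_apply, PiLp.smul_apply, smul_eq_mul, hc.1, hc.2.1, hc.2.2, h0.1, h1.2.1, h2.2.2,
    EuclideanSpace.inner_single_right, PiLp.single_apply]
  simp
  ring

/-- H4: Type-I decay in time with constant `Cw` (`‖wit‖ ≤ amp e^{t/2} ≤ 1/√(−t)` as
`√(−t) e^{t/2} ≤ 1`). -/
theorem wit_h4 : H4 Cw wit := by
  intro t ht x
  have hs : 0 < Real.sqrt (-t) := Real.sqrt_pos.2 (by linarith)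
  rw [le_div_iff₀ hs]
  have h1 := norm_wit_le t x
  have h2 : Real.sqrt (-t) * Real.exp (t / 2) ≤ 1 := by
    have := sqrt_mul_exp_neg_half_le_one (by linarith : 0 ≤ -t)
    simpa [neg_neg] using this
  calc ‖wit t x‖ * Real.sqrt (-t) ≤ amp * Real.exp (t / 2) * Real.sqrt (-t) := by gcongr
    _ = amp * (Real.sqrt (-t) * Real.exp (t / 2)) := by ring
    _ ≤ 1 * 1 := mul_le_mul amp_le_one h2 (by positivity) zero_le_one
    _ ≤ Cw := by rw [one_mul]; exact one_le_Cw

/-- H5: both scale-invariant local energies of the witness are `≤ Cw` on every backward parabolic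
cylinder (the Gaussian mass handles `r ≥ 1`, the ball volume `r³V₁` and `∫e^t ≤ r²` handle `r < 1`). -/
theorem wit_h5 : H5 Cw wit := by
  intro x₀ t₀ r ht₀ hr
  have hIG := IG_nonneg
  have hV := V1_nonneg
  refine ⟨fun t _ ht => ?_, ?_⟩
  · -- slice energy
    have ht' : t ≤ 0 := by linarith
    rcases le_or_gt 1 r with hr1 | hr1
    · -- r ≥ 1: Gaussian mass
      have h1 := setIntegral_norm_wit_sq_le t x₀ r
      have h2 : Real.exp t * IG ≤ IG := by
        calc Real.exp t * IG ≤ 1 * IG := by gcongr; exact Real.exp_le_one_iff.2 ht'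
          _ = IG := one_mul _
      have h3 : r⁻¹ ≤ 1 := inv_le_one_of_one_le₀ hr1
      calc r⁻¹ * ∫ x in Metric.ball x₀ r, ‖wit t x‖ ^ 2 ≤ 1 * IG := by
            refine mul_le_mul h3 (h1.trans h2) ?_ zero_le_one
            exact integral_nonneg fun x => by positivity
        _ ≤ Cw := by rw [Cw]; nlinarith
    · -- r < 1: ball volume
      have h1 := setIntegral_norm_wit_sq_le' ht' x₀ hr
      calc r⁻¹ * ∫ x in Metric.ball x₀ r, ‖wit t x‖ ^ 2 ≤ r⁻¹ * (r ^ 3 * V1) := by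
            gcongr
        _ = r ^ 2 * V1 := by field_simp
        _ ≤ 1 * V1 := by gcongr; nlinarith
        _ ≤ Cw := by rw [Cw]; nlinarith
  · -- gradient energy
    have hinner : ∀ t, ∫ x in Metric.ball x₀ r, ‖fderiv ℝ (wit t) x‖ ^ 2 ≤ Real.exp t * (16 * IG) :=
      fun t => setIntegral_norm_fderiv_wit_sq_le t x₀ r
    have hexp : IntegrableOn (fun t => Real.exp t * (16 * IG)) (Set.Ioo (t₀ - r ^ 2) t₀) :=
      ((Real.continuous_exp.mul continuous_const).integrableOn_Icc).mono_set Set.Ioo_subset_Icc_self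
    have h1 : ∫ t in Set.Ioo (t₀ - r ^ 2) t₀, ∫ x in Metric.ball x₀ r, ‖fderiv ℝ (wit t) x‖ ^ 2 ≤
        ∫ t in Set.Ioo (t₀ - r ^ 2) t₀, Real.exp t * (16 * IG) :=
      integral_mono_of_nonneg (Filter.Eventually.of_forall fun t => integral_nonneg fun x => by positivity)
        hexp (Filter.Eventually.of_forall hinner)
    have h2 : ∫ t in Set.Ioo (t₀ - r ^ 2) t₀, Real.exp t * (16 * IG) ≤ min 1 (r ^ 2) * (16 * IG) := by
      rw [integral_mul_const]
      exact mul_le_mul_of_nonneg_right (setIntegral_exp_Ioo_le ht₀) (by positivity)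
    have h3 : r⁻¹ * (min 1 (r ^ 2)) ≤ 1 := by
      rcases le_or_gt 1 r with hr1 | hr1
      · calc r⁻¹ * min 1 (r ^ 2) ≤ 1 * 1 := by
              refine mul_le_mul (inv_le_one_of_one_le₀ hr1) (min_le_left _ _) (le_min zero_le_one (sq_nonneg _)) zero_le_one
          _ = 1 := one_mul _
      · calc r⁻¹ * min 1 (r ^ 2) ≤ r⁻¹ * r ^ 2 := by gcongr; exact min_le_right _ _
          _ = r := by field_simp
          _ ≤ 1 := hr1.le
    calc r⁻¹ * ∫ t in Set.Ioo (t₀ - r ^ 2) t₀, ∫ x in Metric.ball x₀ r, ‖fderiv ℝ (wit t) x‖ ^ 2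
        ≤ r⁻¹ * (min 1 (r ^ 2) * (16 * IG)) := by
          refine mul_le_mul_of_nonneg_left (h1.trans h2) (by positivity)
      _ = (r⁻¹ * min 1 (r ^ 2)) * (16 * IG) := by ring
      _ ≤ 1 * (16 * IG) := by gcongr
      _ ≤ Cw := by rw [Cw]; nlinarith

/-- H6: the witness is squeezed, `Λ ≤ 1/8` everywhere (in the frame `e₀, e₁` — any frame works:
`|(−t)⟨∇wit h, h⟩| ≤ amp·[(−t)e^{t/2}]·[2‖x‖²e^{−‖x‖²}]·|h|² ≤ amp |h|²`). -/
theorem wit_h6 : H6 (1 / 8) wit := by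
  intro t ht x
  refine ⟨e0, e1, by simp [e0], by simp [e1], by simp [e0, e1, EuclideanSpace.inner_single_left], fun α β => ?_⟩
  set h : (EuclideanSpace ℝ (Fin 3)) := α • e0 + β • e1 with hh
  have hnorm : ‖h‖ ^ 2 = α ^ 2 + β ^ 2 :=
    norm_sq_smul_add_smul (by simp [e0]) (by simp [e1]) (by simp [e0, e1, EuclideanSpace.inner_single_left]) α β
  rw [← hnorm, fderiv_wit, smul_apply, real_inner_smul_left]
  have ht' : 0 < -t := by linarith
  have h1 : |inner ℝ (DW x h) h| ≤ 2 * (‖x‖ ^ 2 * gauss x) * ‖h‖ ^ 2 := abs_inner_DW_apply_self_le x h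
  have h2 : 2 * (‖x‖ ^ 2 * gauss x) ≤ 1 := two_mul_norm_sq_mul_gauss_le_one x
  have h3 : (-t) * Real.exp (t / 2) ≤ 1 := by
    have := mul_exp_neg_half_le_one ht'.le
    simpa [neg_neg, neg_div] using this
  have h4 : inner ℝ (DW x h) h ≤ ‖h‖ ^ 2 := by
    calc inner ℝ (DW x h) h ≤ |inner ℝ (DW x h) h| := le_abs_self _
      _ ≤ 2 * (‖x‖ ^ 2 * gauss x) * ‖h‖ ^ 2 := h1
      _ ≤ 1 * ‖h‖ ^ 2 := by gcongr
      _ = ‖h‖ ^ 2 := one_mul _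
  calc -t * (amp * Real.exp (t / 2) * inner ℝ (DW x h) h)
      = amp * ((-t) * Real.exp (t / 2)) * inner ℝ (DW x h) h := by ring
    _ ≤ amp * ((-t) * Real.exp (t / 2)) * ‖h‖ ^ 2 := by
        refine mul_le_mul_of_nonneg_left h4 ?_
        exact mul_nonneg amp_pos.le (mul_nonneg ht'.le (Real.exp_pos _).le)
    _ ≤ amp * 1 * ‖h‖ ^ 2 := by gcongr; exact amp_pos.le
    _ = 1 / 8 * ‖h‖ ^ 2 := by rw [amp]; ring

/-- The witness is not zero: `wit (−1) e₀ = amp e^{−1/2} e^{−1} e₁ ≠ 0`. -/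
theorem wit_ne_zero : wit (-1) e0 ≠ 0 := by
  rw [wit, vortexW, rot_e0, smul_smul]
  exact smul_ne_zero (mul_pos (coef_pos _) (gauss_pos _)).ne' e1_ne_zero

/-- The crux with ONLY the KNSS-mild clause H3 deleted. -/
def MustSqueezeWithoutH3 : Prop :=
  ∀ (C : ℝ) (u : ℝ → (EuclideanSpace ℝ (Fin 3)) → (EuclideanSpace ℝ (Fin 3))), H1 u ∧ H2 u ∧ H4 C u ∧ H5 C u → H6 (1 / 8) u → VanishesOnPast u

/-- **Any proof must use the Oseen identity H3.** With H3 deleted the statement is false: the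
Gaussian vortex `wit` satisfies every other clause with constant `Cw` and is not zero.  Read
together with §1: the typed side clauses H1, H2, H4, H5, H6 are jointly satisfiable by a nonzero
smooth field, so they hide no junk — the crux is exactly as strong as its PDE content. -/
theorem mustSqueeze_false_without_H3 : ¬ MustSqueezeWithoutH3 := fun h =>
  wit_ne_zero (h Cw wit ⟨wit_h1, wit_h2, wit_h4, wit_h5⟩ wit_h6 (-1) (by norm_num) e0)


end Summit.NavierStokesRegularity.NavierStokesRegularity.Theorems.MustSqueeze.Negative
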